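import Summits.SmoothPoincare4.SmoothPoincare4.Theses.WeakReductionDescent
import Summits.SmoothPoincare4.SmoothPoincare4.Theses.SblfDescent
import Literature.Topology.FourManifolds.SphereTrisectionsSectors
import Literature.Topology.FourManifolds.TrisectionFunctorGKNaturality
import Literature.Topology.FourManifolds.Morse
import Literature.Topology.FourManifolds.MazurDouble
import Literature.Topology.FourManifolds.Gluing

/-!
# Crux `WeakReductionDescent.DependentTripleAtThree` (stmt-SmoothPoincare4-17999) — ideator 1, round 1:
# first lemmas of the two idea cards `poenaru-one-cork-up` and `simplified-monodromy-genus-three`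

Everything here ELABORATES; the logic lemmas are proved (no sorry), the transfers are `def … : Prop`.

Common ground (both cards): at rung 3 "minimal" = "exotic" (`LowGenusBase`), so the crux is implied by
the MANIFOLD-LEVEL statement `GenusThreeStandard` by vacuity (`dependentTripleAtThree_of_genusThreeStandard`,
proved: Gay–Kirby's genus-0 trisection of S⁴ pulled back contradicts minimality), with no Aranda–Zupan input.

Card 1 (`poenaru-one-cork-up`): GenusThreeStandard ⇐ item stmt-SmoothPoincare4-0435 (`GtriMorse1121`, the
(c₁,c₃) = (1,1) handle problem) ∧ the handle reading `Morse11211OfGenusThree` (Gay–Kirby/MSZ: a (3;1,1,1)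
trisection gives a Morse function of profile (1,1,2,1,1)); and ⇐ `MazurDoublesStandard` (every gluing of two
Mazur-type contractibles is S⁴ = "Poénaru's Cor 8.6 one cork up") ∧ `MazurSplittingOfMorse11211` (the Euclid
slide: a (1,1,2,1,1) homotopy sphere is such a gluing).

Card 2 (`simplified-monodromy-genus-three`): GenusThreeStandard-for-minimal ⇐ `GenusThreeToSblfOne` (a minimal
genus-3 trisected homotopy sphere admits a genus-1 simplified broken Lefschetz fibration with no Lefschetz point =
Baykur–Saeki's (g,k,ℓ) = (1,0,1) class, whose simplified trisections are exactly the (3;1) ones) ∧ the route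
SblfDescent's KNOWN support `RungOne` (Hayano / Baykur–Kamada genus-1 classification).
-/

noncomputable section

set_option linter.dupNamespace false

open scoped Manifold ContDiff Topology ContinuousMap
open Set Function Filter Literature.Topology.FourManifolds

namespace Summit.SmoothPoincare4.SmoothPoincare4.Cruxes.DependentTripleAtThree.Ideator1

local notation "𝕊⁴" => (Metric.sphere (0 : EuclideanSpace ℝ (Fin 5)) 1)

/-! ## Common ground: the manifold-level statement and the vacuity glue -/

/-- **C⁺₀ `GenusThreeStandard`**: every smooth homotopy 4-sphere (Statement's bare binders) admitting a
genus-3 Gay–Kirby trisection is diffeomorphic to S⁴ (for a homotopy sphere genus 3 forces type (3;1,1,1),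
`Literature.Barriers.SmoothPoincare4.exotic_trisection_constraints`). -/
def GenusThreeStandard : Prop :=
  ∀ (M : Type) [TopologicalSpace M] [T2Space M] [SecondCountableTopology M]
    [ChartedSpace (EuclideanSpace ℝ (Fin 4)) M] [IsManifold (𝓡 4) ∞ M],
    (M ≃ₕ 𝕊⁴) → ∀ (k : Fin 3 → ℕ) (T : Fin 3 → Set M), IsGKTrisection M 3 k T →
      Nonempty (M ≃ₘ⟮𝓡 4, 𝓡 4⟯ 𝕊⁴)

/-- The same with the crux's minimality hypothesis kept (what card 2 reaches). -/
def MinimalGenusThreeStandard : Prop :=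
  ∀ (M : Type) [TopologicalSpace M] [T2Space M] [SecondCountableTopology M]
    [ChartedSpace (EuclideanSpace ℝ (Fin 4)) M] [IsManifold (𝓡 4) ∞ M],
    (M ≃ₕ 𝕊⁴) → ∀ (k : Fin 3 → ℕ) (T : Fin 3 → Set M), IsGKTrisection M 3 k T →
      (∀ (g' : ℕ) (k' : Fin 3 → ℕ) (T' : Fin 3 → Set M), IsGKTrisection M g' k' T' → 3 ≤ g') →
      Nonempty (M ≃ₘ⟮𝓡 4, 𝓡 4⟯ 𝕊⁴)

theorem minimalGenusThreeStandard_of (h : GenusThreeStandard) : MinimalGenusThreeStandard :=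
  fun M _ _ _ _ _ e k T hT _ => h M e k T hT

/-- A diffeomorphism to the round sphere makes genus 3 non-minimal (Gay–Kirby's genus-0 trisection of S⁴,
`sphere_genusZero_gkTrisection_holds`, pulled back by `IsGKTrisection.image_diffeomorph'`; both PROVED). -/
theorem not_minimal_three_of_diffeomorph {M : Type} [TopologicalSpace M]
    [ChartedSpace (EuclideanSpace ℝ (Fin 4)) M] [IsManifold (𝓡 4) ∞ M]
    (Φ : M ≃ₘ⟮𝓡 4, 𝓡 4⟯ 𝕊⁴)
    (hmin : ∀ (g' : ℕ) (k' : Fin 3 → ℕ) (T' : Fin 3 → Set M), IsGKTrisection M g' k' T' → 3 ≤ g') :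
    False := by
  obtain ⟨S₀, hS₀⟩ := sphere_genusZero_gkTrisection_holds
  have h0 := hmin 0 (fun _ => 0) (fun i => Φ.symm '' S₀ i) (hS₀.isGKTrisection.image_diffeomorph' Φ.symm)
  omega

/-- **Vacuity glue (PROVED): the crux follows from the manifold-level statement, even in its minimal form.** -/
theorem dependentTripleAtThree_of_minimalGenusThreeStandard (h : MinimalGenusThreeStandard) :
    Theses.WeakReductionDescent.DependentTripleAtThree := by
  intro M _ _ _ _ _ e k T hT hmin
  obtain ⟨Φ⟩ := h M e k T hT hmin
  exact (not_minimal_three_of_diffeomorph Φ hmin).elim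

theorem dependentTripleAtThree_of_genusThreeStandard (h : GenusThreeStandard) :
    Theses.WeakReductionDescent.DependentTripleAtThree :=
  dependentTripleAtThree_of_minimalGenusThreeStandard (minimalGenusThreeStandard_of h)

/-! ## Card 1 — `poenaru-one-cork-up`: the handle / Mazur-double reading -/

/-- **First lemma of card 1 (theorem-level, Gay–Kirby Lemma 13 / MSZ16 §2 + χ = 2 ⇒ k = (1,1,1)):**
a genus-3 GK-trisection of a smooth homotopy 4-sphere yields a Morse function with exactly
1, 1, 2, 1, 1 critical points of index 0, 1, 2, 3, 4 (sector `S 0` = 0-handle ∪ one 1-handle, the two 2-handles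
from `S 1`, the 3- and 4-handle from `S 2`). -/
def Morse11211OfGenusThree : Prop :=
  ∀ (M : Type) [TopologicalSpace M] [T2Space M] [SecondCountableTopology M]
    [ChartedSpace (EuclideanSpace ℝ (Fin 4)) M] [IsManifold (𝓡 4) ∞ M],
    (M ≃ₕ 𝕊⁴) → ∀ (k : Fin 3 → ℕ) (T : Fin 3 → Set M), IsGKTrisection M 3 k T →
      ∃ f : M → ℝ, IsMorse (𝓡 4) f ∧
        (criticalSetOfIndex (𝓡 4) f 0).ncard = 1 ∧ (criticalSetOfIndex (𝓡 4) f 1).ncard = 1 ∧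
        (criticalSetOfIndex (𝓡 4) f 2).ncard = 2 ∧ (criticalSetOfIndex (𝓡 4) f 3).ncard = 1 ∧
        (criticalSetOfIndex (𝓡 4) f 4).ncard = 1

/-- Item stmt-SmoothPoincare4-0435 `gtri_morse_1121` VERBATIM (route GroupTrisection, crux rank 3, OPEN in its
(c₁,c₃) = (1,1) case = two 2-handles attached to S¹×S² returning S¹×S²): the transfer target of card 1. -/
def GtriMorse1121 : Prop :=
  ∀ (M : Type) [TopologicalSpace M] [T2Space M] [SecondCountableTopology M] [ChartedSpace (EuclideanSpace ℝ (Fin 4)) M] [IsManifold (𝓡 4) ((⊤ : ℕ∞) : WithTop ℕ∞) M] [CompactSpace M], M ≃ₕ Metric.sphere (0 : EuclideanSpace ℝ (Fin 5)) 1 → ∀ f : M → ℝ, Literature.Topology.FourManifolds.IsMorse (𝓡 4) f → (Literature.Topology.FourManifolds.criticalSetOfIndex (𝓡 4) f 0).ncard = 1 → (Literature.Topology.FourManifolds.criticalSetOfIndex (𝓡 4) f 1).ncard ≤ 1 → (Literature.Topology.FourManifolds.criticalSetOfIndex (𝓡 4) f 3).ncard ≤ 1 → (Literature.Topology.FourManifolds.criticalSetOfIndex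 (𝓡 4) f 4).ncard = 1 → Nonempty (Diffeomorph (𝓡 4) (𝓡 4) M (Metric.sphere (0 : EuclideanSpace ℝ (Fin 5)) 1) ((⊤ : ℕ∞) : WithTop ℕ∞))

/-- **Card 1, transfer to the hub's existing (1,2,1) item (PROVED logic):** `GtriMorse1121` (stmt-0435) and the
handle reading give `GenusThreeStandard`, hence the crux. -/
theorem genusThreeStandard_of_gtriMorse1121 (h : GtriMorse1121) (hM : Morse11211OfGenusThree) :
    GenusThreeStandard := by
  intro M _ _ _ _ _ e k T hT
  haveI : CompactSpace M := hT.compactSpace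
  obtain ⟨f, hf, h0, h1, -, h3, h4⟩ := hM M e k T hT
  exact h M e f hf h0 h1.le h3.le h4

/-- **C⁺₁ `MazurDoublesStandard` — "Poénaru's theorem one cork up" / Property R for Mazur fillings.**
A *Mazur-type* 4-manifold is a compact contractible smooth `W` with a handle decomposition with exactly one
handle of each index 0, 1, 2 (tree: `HasHandleDecomposition 3 W (1,1,1,0,…)`, as in
`Literature.Topology.FourManifolds.Mazur1961_double_sphere_four`).  Statement: every closed smooth 4-manifold
`P` that is a boundary gluing `W₁ ∪_φ W₂` of two Mazur-type manifolds along ANY diffeomorphism of their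
boundaries is diffeomorphic to S⁴.  (φ = id and W₁ = W₂: Mazur 1961; in general OPEN — it contains the twisted
doubles of every Mazur-type cork, Gompf arXiv:1603.05090 Q 2.2, and the Akbulut–Kirby 1979 pairs.) -/
def MazurDoublesStandard : Prop :=
  ∀ (W₁ : Type) [TopologicalSpace W₁] [T2Space W₁] [SecondCountableTopology W₁]
    [ChartedSpace (EuclideanHalfSpace 4) W₁] [IsManifold (𝓡∂ 4) ∞ W₁] [CompactSpace W₁] [ContractibleSpace W₁]
    (W₂ : Type) [TopologicalSpace W₂] [T2Space W₂] [SecondCountableTopology W₂]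
    [ChartedSpace (EuclideanHalfSpace 4) W₂] [IsManifold (𝓡∂ 4) ∞ W₂] [CompactSpace W₂] [ContractibleSpace W₂],
    HasHandleDecomposition 3 W₁ (fun k => if k ≤ 2 then 1 else 0) →
    HasHandleDecomposition 3 W₂ (fun k => if k ≤ 2 then 1 else 0) →
    ∀ (b₁ : BoundaryData (𝓡∂ 4) W₁ (𝓡 3)) (b₂ : BoundaryData (𝓡∂ 4) W₂ (𝓡 3))
      (φ : b₁.carrier ≃ₘ⟮𝓡 3, 𝓡 3⟯ b₂.carrier)
      (P : Type) [TopologicalSpace P] [T2Space P] [SecondCountableTopology P]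
      [ChartedSpace (EuclideanSpace ℝ (Fin 4)) P] [IsManifold (𝓡 4) ∞ P],
      IsBoundaryGluing b₁ b₂ φ (𝓡 4) P → Nonempty (P ≃ₘ⟮𝓡 4, 𝓡 4⟯ 𝕊⁴)

/-- **The Euclid slide (theorem-level, Kirby calculus; the converse of the landed
`…PropertyRMazurHalves.stub_mazurGluedProfile`):** a closed smooth homotopy 4-sphere with a Morse function of
profile (1,1,2,1,1) is a boundary gluing of two Mazur-type contractibles — slide the two 2-handles until their
winding numbers in H₁(S¹×B³) = ℤ are (1,0) (Euclid on a coprime pair, coprime because π₁ = 1); then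
W₁ := (0h ∪ 1h ∪ first 2h) is contractible with homology-sphere boundary, and W₂ := (second 2h ∪ 3h ∪ 4h)
turned upside down is Mazur-type as well. -/
def MazurSplittingOfMorse11211 : Prop :=
  ∀ (M : Type) [TopologicalSpace M] [T2Space M] [SecondCountableTopology M]
    [ChartedSpace (EuclideanSpace ℝ (Fin 4)) M] [IsManifold (𝓡 4) ∞ M],
    (M ≃ₕ 𝕊⁴) → ∀ f : M → ℝ, IsMorse (𝓡 4) f →
      (criticalSetOfIndex (𝓡 4) f 0).ncard = 1 → (criticalSetOfIndex (𝓡 4) f 1).ncard = 1 →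
      (criticalSetOfIndex (𝓡 4) f 2).ncard = 2 → (criticalSetOfIndex (𝓡 4) f 3).ncard = 1 →
      (criticalSetOfIndex (𝓡 4) f 4).ncard = 1 →
      ∃ (W₁ : Type) (_ : TopologicalSpace W₁) (_ : T2Space W₁) (_ : SecondCountableTopology W₁)
        (_ : ChartedSpace (EuclideanHalfSpace 4) W₁) (_ : IsManifold (𝓡∂ 4) ∞ W₁) (_ : CompactSpace W₁)
        (_ : ContractibleSpace W₁)
        (W₂ : Type) (_ : TopologicalSpace W₂) (_ : T2Space W₂) (_ : SecondCountableTopology W₂)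
        (_ : ChartedSpace (EuclideanHalfSpace 4) W₂) (_ : IsManifold (𝓡∂ 4) ∞ W₂) (_ : CompactSpace W₂)
        (_ : ContractibleSpace W₂)
        (b₁ : BoundaryData (𝓡∂ 4) W₁ (𝓡 3)) (b₂ : BoundaryData (𝓡∂ 4) W₂ (𝓡 3))
        (φ : b₁.carrier ≃ₘ⟮𝓡 3, 𝓡 3⟯ b₂.carrier),
        HasHandleDecomposition 3 W₁ (fun k => if k ≤ 2 then 1 else 0) ∧
        HasHandleDecomposition 3 W₂ (fun k => if k ≤ 2 then 1 else 0) ∧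
        IsBoundaryGluing b₁ b₂ φ (𝓡 4) M

/-- **Card 1 assembled (PROVED logic): C⁺₁ + Euclid slide + handle reading ⇒ GenusThreeStandard ⇒ crux.** -/
theorem genusThreeStandard_of_mazurDoubles (hD : MazurDoublesStandard) (hS : MazurSplittingOfMorse11211)
    (hM : Morse11211OfGenusThree) : GenusThreeStandard := by
  intro M _ _ _ _ _ e k T hT
  obtain ⟨f, hf, h0, h1, h2, h3, h4⟩ := hM M e k T hT
  obtain ⟨W₁, _, _, _, _, _, _, _, W₂, _, _, _, _, _, _, _, b₁, b₂, φ, hW₁, hW₂, hglue⟩ :=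
    hS M e f hf h0 h1 h2 h3 h4
  exact hD W₁ W₂ hW₁ hW₂ b₁ b₂ φ M hglue

theorem dependentTripleAtThree_of_mazurDoubles (hD : MazurDoublesStandard) (hS : MazurSplittingOfMorse11211)
    (hM : Morse11211OfGenusThree) : Theses.WeakReductionDescent.DependentTripleAtThree :=
  dependentTripleAtThree_of_genusThreeStandard (genusThreeStandard_of_mazurDoubles hD hS hM)

/-! ## Card 2 — `simplified-monodromy-genus-three`: through simplified trisections to genus-1 SBLFs -/

/-- The hypothesis of route SblfDescent's support item `RungOne` (stmt-SmoothPoincare4-18531), verbatim: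
"M carries a simplified broken Lefschetz fibration of LOWER genus 0 (genus-1 SBLF, non-empty round locus)". -/
def HasSblfOfLowerGenusZero (M : Type) [TopologicalSpace M] [T2Space M] [SecondCountableTopology M]
    [ChartedSpace (EuclideanSpace ℝ (Fin 4)) M] [IsManifold (𝓡 4) ∞ M] : Prop :=
  (∃ (o : Literature.Topology.FourManifolds.SmoothOrientation (𝓡 4) M) (f : M → (Metric.sphere (0 : EuclideanSpace ℝ (Fin 3)) 1)) (L : Finset M), let R : M → Prop := fun q => Function.Surjective (mfderiv (𝓡 4) (𝓡 2) f q); let G : (Metric.sphere (0 : EuclideanSpace ℝ (Fin 3)) 1) → ℕ → Prop := fun y n => Nonempty ((Fin (2 * n) → ℤ) ≃ₗ[ℤ] Literature.AlgebraicTopology.SingularHomology.singularHomology ℤ ℤ ↥(f ⁻¹' {y}) 1); ContMDiff (𝓡 4) (𝓡 2) ((⊤ : ℕ∞) : WithTop ℕ∞) f ∧ Function.Surjective f ∧ (∀ p ∈ L, Literature.Topology.FourManifolds.IsLefschetzCriticalPoint (𝓡 4) (𝓡 2) o f p true) ∧ (∀ p : M, ¬ R p → p ∉ L → ∃ (φ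 : OpenPartialHomeomorph M (EuclideanSpace ℝ (Fin 4))) (ψ : OpenPartialHomeomorph (Metric.sphere (0 : EuclideanSpace ℝ (Fin 3)) 1) (EuclideanSpace ℝ (Fin 2))), p ∈ φ.source ∧ φ p = 0 ∧ Set.MapsTo f φ.source ψ.source ∧ ContMDiffOn (𝓡 4) (𝓡 4) ((⊤ : ℕ∞) : WithTop ℕ∞) φ φ.source ∧ ContMDiffOn (𝓡 4) (𝓡 4) ((⊤ : ℕ∞) : WithTop ℕ∞) φ.symm φ.target ∧ ContMDiffOn (𝓡 2) (𝓡 2) ((⊤ : ℕ∞) : WithTop ℕ∞) ψ ψ.source ∧ ContMDiffOn (𝓡 2) (𝓡 2) ((⊤ : ℕ∞) : WithTop ℕ∞) ψ.symm ψ.target ∧ ∀ q ∈ φ.source, (ψ (f q)) 0 = (φ q) 0 ∧ (ψ (f q)) 1 = (φ q) 1 ^ 2 + (φ q) 2 ^ 2 - (φ q) 3 ^ 2) ∧ IsConnected ({p : M | ¬ R p} \ (↑L : Set M)) ∧ Set.InjOn f {p : M | ¬ R p} ∧ (∀ y, (∀ q, f q = y → R q) → IsConnected (f ⁻¹' {y})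 ∧ (G y (0 + 1) ∨ G y (0))) ∧ (∃ y, (∀ q, f q = y → R q) ∧ G y (0 + 1)) ∧ (∃ y, (∀ q, f q = y → R q) ∧ G y (0)) ∧ (∀ p ∈ L, ∀ᶠ y in nhds (f p), (∀ q, f q = y → R q) → G y (0 + 1)))

/-- **C⁺₂ `GenusThreeToSblfOne` (K1 of card 2):** a smooth homotopy 4-sphere with a MINIMAL genus-3
GK-trisection admits a genus-1 simplified broken Lefschetz fibration (non-empty round locus); the intended
route is Baykur–Saeki's correspondence at (g,k,ℓ) = (1,0,1) ⟷ simplified (3;1)-trisections (arXiv:1710.06529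
Thm 3.2) after simplifying the trisection MAP at fixed genus (Cerf boxes emptied by R2/R3 moves, Hayano's
R2-calculus). -/
def GenusThreeToSblfOne : Prop :=
  ∀ (M : Type) [TopologicalSpace M] [T2Space M] [SecondCountableTopology M]
    [ChartedSpace (EuclideanSpace ℝ (Fin 4)) M] [IsManifold (𝓡 4) ∞ M],
    (M ≃ₕ 𝕊⁴) → ∀ (k : Fin 3 → ℕ) (T : Fin 3 → Set M), IsGKTrisection M 3 k T →
      (∀ (g' : ℕ) (k' : Fin 3 → ℕ) (T' : Fin 3 → Set M), IsGKTrisection M g' k' T' → 3 ≤ g') →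
      HasSblfOfLowerGenusZero M

/-- **Card 2 assembled (PROVED logic): K1 + SblfDescent's KNOWN `RungOne` ⇒ the crux.** -/
theorem dependentTripleAtThree_of_sblfOne (h1 : GenusThreeToSblfOne) (hR : Theses.SblfDescent.RungOne) :
    Theses.WeakReductionDescent.DependentTripleAtThree := by
  refine dependentTripleAtThree_of_minimalGenusThreeStandard ?_
  intro M _ _ _ _ _ e k T hT hmin
  exact hR M e (h1 M e k T hT hmin)

end Summit.SmoothPoincare4.SmoothPoincare4.Cruxes.DependentTripleAtThree.Ideator1
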